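import Literature.AlgebraicGeometry.Motives.HodgeThetaAnnihilatorTimesRankOneTorus
import Literature.AlgebraicGeometry.Motives.HodgeStructureCMGaloisFormOrthogonality
import Literature.AlgebraicGeometry.Motives.HodgeStructureCMSesquilinearFormGalois
import Literature.AlgebraicGeometry.Motives.HodgeStructureCMActionScalarExtension
import Literature.AlgebraicGeometry.Motives.HodgeStructureHalfTwistPolarization
import HarnessLib

/-!
# The skew commutant of a CM field acting with eigenlines is the complexified minus part: `{Y : [Y, E_ℂ] = 0, ψ_ℂ-skew} = (E⁻)_ℂ` (Moonen–Zarhin 1999 §2 (2.3): `hg(X) ⊆ 𝔲_F`, `𝔲_F = Lie U_F = F⁻`, for `X` of CM type by `F`)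

Family `hodge`, layer `Literature/AlgebraicGeometry/Motives` (abstract polarizable `ℚ`-Hodge structures with an
action of a CM field; no geometry). Research context: cell `pub-hodge-ring2` (HONEST FRAMING: research route
conditional on HC_CM; not a corollary; Q11.4-sentence-2 already refuted in dim ≥ 3), Literature lane, programme
R28b (Moonen–Zarhin 1999 (5.10): `S × T`, `S` a simple CM surface) — the supplier of the `V₂`-side hypotheses
(COMM), (NOSQ) and the commutation/skewness clauses of `HodgeThetaAnnihilatorRankOneCentreTimesQSimpleTorus`.
UNCONDITIONAL linear algebra; theorems only (no definition, no named fact, D-0026; nothing admitted).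

SETTING. `H` a `ℚ`-Hodge structure on `V`, `E` a CM field acting by Hodge endomorphisms (`A : EndAction H E`),
`ψ` a polarization COMPATIBLE with the action (`ψ(ev, w) = ψ(v, ēw)`, van Geemen's «polarization of Weil type»;
one always exists, the tree's `IsPolarizable.exists_isCompatible`), and EVERY JOINT EIGENSPACE
`V_σ = {x ∈ V_ℂ | e·x = σ(e)x}` (`σ : E → ℂ`) A LINE (`dim_ℚ V = [E:ℚ]`: the `H¹` of an abelian variety with
complex multiplication by `E`, Shimura §3.2 / §5.2). The minus part `E⁻ = {y | ȳ = -y} = Lie U_E` (Moonen–Zarhin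
§2 (2.1): «`U_F = Ker(Nm : F^* → F₀^*)`», (2.3): «`Hg(X) ⊆ U_F(V, ψ)`») enters as a `ℚ`-subspace `S ⊆ E` with
`y ∈ S ↔ ȳ = -y` (no definition is introduced; the consumer passes `S`).

RESULTS (all for `𝔲 := S.map ι`, the operators `y·`, `y ∈ E⁻`).
* `form_add_eq_zero_of_isCompatible` — `y ∈ E⁻` acts `ψ`-skew: `ψ(yv, w) + ψ(v, yw) = 0`.
* `commute_ι_of_mem_map`, `commute_of_mem_map` — `𝔲` commutes with `ι(E)` and is commutative.
* **`mem_spanC_map_of_commute_of_skew`** — (COMM): every `ψ_ℂ`-skew complex operator commuting with `ι(E)_ℂ`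
  lies in `𝔲_ℂ`. Proof: such a `Y` preserves each line `V_σ = ℂv_σ`, `Yv_σ = c_σ v_σ`; a compatible `ψ_ℂ` pairs
  `V_σ` only with `V_σ̄` (the tree's `galois_form_eq_zero_of_ne_conjugate`) and non-degenerately, so
  `c_σ̄ = -c_σ` and `Y` is determined by `(c_σ)` on one embedding per infinite place: the space `D` of such `Y`
  has `dim_ℂ D ≤ #places = [E:ℚ]/2`; and `𝔲_ℂ ⊆ D` with `dim_ℂ 𝔲_ℂ = dim_ℚ E⁻ ≥ [E:ℚ]/2` (rank–nullity for
  `x ↦ y₀(x + x̄)`, `y₀ ∈ E⁻ ∖ 0`), hence `D = 𝔲_ℂ`.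
* `mul_self_ne_smul_one_of_mem_map` — (NOSQ) transported: if no non-zero `y ∈ E⁻` has `y² ∈ ℚ` («`F` does
  not contain an imaginary quadratic field»), no non-zero element of `𝔲` has square in `ℚ·1`.

## References

* [MoonenZarhin1999LowDim] B. Moonen, Yu. Zarhin, Math. Ann. 315 (1999), §2 (2.1)–(2.3), §5 (5.10) (held
  `paper:arxiv-math_9901113` pp. 3–4, 10). [cite: MoonenZarhin1999LowDim, §2 (2.3)]
* [vanGeemen1994HodgeAV] B. van Geemen, LNM 1594 (1994), Lemma 5.2 (1) (compatible polarizations).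
  [cite: vanGeemen1994HodgeAV, Lemma 5.2 (1)]
* [Deligne1982HodgeCycles] P. Deligne, LNM 900 (1982), I §4 (p. 30: `H¹_B ⊗ ℂ = ⊕_σ H¹_{B,σ}`), §3 (proof of
  Prop. 3.4: rational structures). [cite: Deligne1982HodgeCycles, I §4]
* [Shimura1998] G. Shimura, *Abelian Varieties with Complex Multiplication and Modular Functions* (1998), §3.2,
  §5.2 (eigenlines of the rational representation). [cite: Shimura1998, §5.2]
-/

noncomputable section

open scoped TensorProduct
open Module NumberField

namespace Literature.AlgebraicGeometry.Motives

namespace HodgeStructure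

namespace EndAction

universe u

variable {V : Type u} [AddCommGroup V] [Module ℚ V] {n : ℤ} {H : HodgeStructure V n}
variable {E : Type*} [Field E] [NumberField E] [IsCMField E] (A : EndAction H E)
variable (S : Submodule ℚ E) (hS : ∀ y : E, y ∈ S ↔ IsCMField.complexConj E y = -y)

/-! ### §1 `E⁻` acts by commuting `ψ`-skew operators -/

/-- **`y ∈ E⁻` acts `ψ`-skew for a compatible polarization**: `ψ(yv, w) = ψ(v, ȳw) = -ψ(v, yw)`.
[cite: MoonenZarhin1999LowDim, §2 (2.3)] [cite: vanGeemen1994HodgeAV, Lemma 5.2 (1)] -/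
theorem form_add_eq_zero_of_isCompatible {ψ : Polarization H} (hc : A.IsCompatible ψ.form) {y : E}
    (hy : IsCMField.complexConj E y = -y) (v w : V) : ψ.form (A.ι y v) w + ψ.form v (A.ι y w) = 0 := by
  rw [hc y v w, hy, map_neg, LinearMap.neg_apply, map_neg, neg_add_cancel]

include hS in
/-- Every element of `𝔲 = E⁻·` is `ψ`-skew (compatible `ψ`). [cite: MoonenZarhin1999LowDim, §2 (2.3)] -/
theorem form_add_eq_zero_of_mem_map {ψ : Polarization H} (hc : A.IsCompatible ψ.form)
    {Y : Module.End ℚ V} (hY : Y ∈ S.map A.ι.toLinearMap) (v w : V) : ψ.form (Y v) w + ψ.form v (Y w) = 0 := by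
  obtain ⟨y, hy, rfl⟩ := Submodule.mem_map.1 hY
  exact A.form_add_eq_zero_of_isCompatible hc ((hS y).1 hy) v w

omit [IsCMField E] in
/-- `𝔲` commutes with `ι(E)` (`E` is commutative). [cite: MoonenZarhin1999LowDim, §2 (2.1)] -/
theorem commute_ι_of_mem_map {Y : Module.End ℚ V} (hY : Y ∈ S.map A.ι.toLinearMap) (e : E) :
    Y * A.ι e = A.ι e * Y := by
  obtain ⟨y, _, rfl⟩ := Submodule.mem_map.1 hY
  change A.ι y * A.ι e = A.ι e * A.ι y
  rw [← map_mul, ← map_mul, mul_comm]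

omit [IsCMField E] in
/-- `𝔲` is commutative. [cite: MoonenZarhin1999LowDim, §2 (2.1)] -/
theorem commute_of_mem_map {Y Y' : Module.End ℚ V} (hY : Y ∈ S.map A.ι.toLinearMap)
    (hY' : Y' ∈ S.map A.ι.toLinearMap) : Y * Y' = Y' * Y := by
  obtain ⟨y', _, rfl⟩ := Submodule.mem_map.1 hY'
  exact A.commute_ι_of_mem_map S hY y'

/-! ### §2 (NOSQ) transported to operators -/

include hS in
/-- **(NOSQ) on operators**: if no non-zero `y ∈ E⁻` has rational square («`F` does not contain an imaginary
quadratic field»), then no non-zero `Y ∈ 𝔲` has `Y² ∈ ℚ·1` (`ι` is injective on the field `E`).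
[cite: MoonenZarhin1999LowDim, §5 (5.10)] -/
theorem mul_self_ne_smul_one_of_mem_map [Nontrivial V]
    (hnosq : ∀ y : E, IsCMField.complexConj E y = -y → y ≠ 0 → ∀ r : ℚ, y * y ≠ algebraMap ℚ E r)
    {Y : Module.End ℚ V} (hY : Y ∈ S.map A.ι.toLinearMap) (hY0 : Y ≠ 0) (r : ℚ) : Y * Y ≠ r • 1 := by
  obtain ⟨y, hy, rfl⟩ := Submodule.mem_map.1 hY
  change A.ι y ≠ 0 at hY0
  change A.ι y * A.ι y ≠ r • 1
  have hy0 : y ≠ 0 := by rintro rfl; exact hY0 (map_zero _)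
  intro h
  apply hnosq y ((hS y).1 hy) hy0 r
  apply (A.ι : E →ₐ[ℚ] Module.End ℚ V).toRingHom.injective
  change A.ι (y * y) = A.ι (algebraMap ℚ E r)
  rw [map_mul, h, AlgHom.commutes, Algebra.algebraMap_eq_smul_one]

/-! ### §3 (COMM): the skew commutant of `ι(E)_ℂ` is `𝔲_ℂ` when all eigenspaces are lines -/

include hS in
/-- **The `ψ_ℂ`-skew commutant of `E_ℂ` is `(E⁻)_ℂ`** (all joint eigenspaces `V_σ` lines, `ψ` compatible): a
complex operator commuting with every `ι(e)_ℂ` and skew for `ψ_ℂ` lies in the complex span of the operators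
`ι(y)`, `y ∈ E⁻`. («`Hg(Y₁) = U_{F₁}`», `hg ⊆ 𝔲_F = F⁻`: the Lie algebra `{Y | [Y,F] = 0, Y skew}` of `U_F(V,ψ)`
is `F⁻` when `V` is a line over `F ⊗ ℂ` eigenspace by eigenspace.) [cite: MoonenZarhin1999LowDim, §2 (2.3) and §5 (5.10)]
[cite: Deligne1982HodgeCycles, I §4] [cite: Shimura1998, §5.2] -/
theorem mem_spanC_map_of_commute_of_skew [Module.Finite ℚ V]
    (hline : ∀ σ : E →+* ℂ,
      Module.finrank ℂ ↥(⨅ e : E, Module.End.eigenspace ((A.ι e).baseChange ℂ) (σ e)) = 1)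
    (ψ : Polarization H) (hc : A.IsCompatible ψ.form) {Y : Module.End ℂ (ℂ ⊗[ℚ] V)}
    (hYc : ∀ e : E, Y * (A.ι e).baseChange ℂ = (A.ι e).baseChange ℂ * Y)
    (hYs : ∀ x y, ψ.form.baseChange ℂ (Y x) y + ψ.form.baseChange ℂ x (Y y) = 0) :
    Y ∈ spanC (S.map A.ι.toLinearMap) := by
  classical
  -- the eigenline basis `b σ ∈ V_σ`
  set W : (E →+* ℂ) → Submodule ℂ (ℂ ⊗[ℚ] V) :=
    fun σ => ⨅ e : E, Module.End.eigenspace ((A.ι e).baseChange ℂ) (σ e) with hW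
  have hint : DirectSum.IsInternal W := A.isInternal_iInf_eigenspace
  let bW : ∀ σ, Module.Basis (Fin 1) ℂ (W σ) := fun σ => Module.finBasisOfFinrankEq ℂ (W σ) (hline σ)
  set b₀ : Module.Basis (Σ _ : E →+* ℂ, Fin 1) ℂ (ℂ ⊗[ℚ] V) := hint.collectedBasis bW with hb₀
  set eσ : (Σ _ : E →+* ℂ, Fin 1) ≃ (E →+* ℂ) :=
    { toFun := fun p => p.1
      invFun := fun σ => ⟨σ, 0⟩
      left_inv := by rintro ⟨σ, i⟩; rw [Fin.fin_one_eq_zero i]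
      right_inv := fun _ => rfl } with heσ
  set b : Module.Basis (E →+* ℂ) ℂ (ℂ ⊗[ℚ] V) := b₀.reindex eσ with hbdef
  have hb : ∀ σ, b σ = ((bW σ 0 : W σ) : ℂ ⊗[ℚ] V) := fun σ => by
    rw [hbdef, Module.Basis.reindex_apply, hb₀, hint.collectedBasis_coe]
    rfl
  have hbmem : ∀ σ, b σ ∈ W σ := fun σ => by rw [hb]; exact (bW σ 0).2
  -- every `x ∈ V_σ` is a multiple of `b σ`, namely `x = (b.repr x σ) • b σ`
  have hlineb : ∀ σ, ∀ x ∈ W σ, ∃ c : ℂ, x = c • b σ := by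
    intro σ x hx
    refine ⟨(bW σ).repr ⟨x, hx⟩ 0, ?_⟩
    have h := (bW σ).sum_repr ⟨x, hx⟩
    rw [Fin.sum_univ_one] at h
    have h' := congrArg Subtype.val h
    rw [Submodule.coe_smul] at h'
    rw [hb, h']
  have hcoord : ∀ σ, ∀ x ∈ W σ, x = (b.repr x σ) • b σ := by
    intro σ x hx
    obtain ⟨c, rfl⟩ := hlineb σ x hx
    rw [map_smul, Finsupp.smul_apply, b.repr_self, Finsupp.single_eq_same, smul_eq_mul, mul_one]
  -- compatible `ψ_ℂ` pairs `V_σ` only with `V_σ̄`, and `ψ_ℂ(b σ, b σ̄) ≠ 0`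
  have hgal := A.galois_of_sesquilinear ψ.form hc
  have horth : ∀ σ τ : E →+* ℂ, τ ≠ ComplexEmbedding.conjugate σ → ψ.form.baseChange ℂ (b σ) (b τ) = 0 :=
    fun σ τ hτ => A.galois_form_eq_zero_of_ne_conjugate ψ.form hgal hτ (hbmem σ) (hbmem τ)
  have hpair : ∀ σ : E →+* ℂ, ψ.form.baseChange ℂ (b σ) (b (ComplexEmbedding.conjugate σ)) ≠ 0 := by
    intro σ h0
    have hall : ∀ τ, ψ.form.baseChange ℂ (b σ) (b τ) = 0 := fun τ => by
      by_cases hτ : τ = ComplexEmbedding.conjugate σ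
      · rw [hτ]; exact h0
      · exact horth σ τ hτ
    have hzero : ψ.form.baseChange ℂ (b σ) = 0 := b.ext fun τ => by rw [hall, LinearMap.zero_apply]
    exact b.ne_zero σ (ψ.eq_zero_of_forall_form_eq_zero fun y => by rw [hzero, LinearMap.zero_apply])
  -- the space `D` of skew operators commuting with `ι(E)_ℂ`
  obtain ⟨D, hD⟩ : ∃ D : Submodule ℂ (Module.End ℂ (ℂ ⊗[ℚ] V)), ∀ Z, Z ∈ D ↔
      (∀ e : E, Z * (A.ι e).baseChange ℂ = (A.ι e).baseChange ℂ * Z) ∧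
      ∀ x y, ψ.form.baseChange ℂ (Z x) y + ψ.form.baseChange ℂ x (Z y) = 0 :=
    ⟨{ carrier := {Z | (∀ e : E, Z * (A.ι e).baseChange ℂ = (A.ι e).baseChange ℂ * Z) ∧
          ∀ x y, ψ.form.baseChange ℂ (Z x) y + ψ.form.baseChange ℂ x (Z y) = 0}
       add_mem' := fun {Z Z'} hZ hZ' => ⟨fun e => by rw [add_mul, mul_add, hZ.1 e, hZ'.1 e], fun x y => by
         simp only [LinearMap.add_apply, map_add]
         linear_combination hZ.2 x y + hZ'.2 x y⟩
       zero_mem' := ⟨fun e => by rw [zero_mul, mul_zero], fun x y => by simp⟩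
       smul_mem' := fun c Z hZ => ⟨fun e => by rw [smul_mul_assoc, mul_smul_comm, hZ.1 e], fun x y => by
         simp only [LinearMap.smul_apply, map_smul, LinearMap.smul_apply, smul_eq_mul]
         rw [← mul_add, hZ.2 x y, mul_zero]⟩ }, fun Z => Iff.rfl⟩
  have hYD : Y ∈ D := (hD Y).2 ⟨hYc, hYs⟩
  -- members of `D` preserve each line: `Z (b σ) = c_σ(Z) • b σ` with `c_σ̄ = -c_σ`
  have hZW : ∀ Z ∈ D, ∀ σ, Z (b σ) ∈ W σ := by
    intro Z hZ σ
    have h := hbmem σ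
    rw [hW, A.mem_iInf_eigenspace_iff] at h ⊢
    intro e
    rw [← Module.End.mul_apply, ← ((hD Z).1 hZ).1 e, Module.End.mul_apply, h e, map_smul]
  have hZb : ∀ Z ∈ D, ∀ σ, Z (b σ) = (b.repr (Z (b σ)) σ) • b σ := fun Z hZ σ => hcoord σ _ (hZW Z hZ σ)
  have hZconj : ∀ Z ∈ D, ∀ σ, b.repr (Z (b (ComplexEmbedding.conjugate σ))) (ComplexEmbedding.conjugate σ) =
      -b.repr (Z (b σ)) σ := by
    intro Z hZ σ
    have h := ((hD Z).1 hZ).2 (b σ) (b (ComplexEmbedding.conjugate σ))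
    rw [hZb Z hZ σ, hZb Z hZ (ComplexEmbedding.conjugate σ), map_smul, LinearMap.smul_apply, map_smul,
      smul_eq_mul, smul_eq_mul, ← add_mul] at h
    have h' := (mul_eq_zero.1 h).resolve_right (hpair σ)
    linear_combination h'
  -- `dim_ℂ D ≤ #(infinite places)`: `Z ↦ (c_{σ_w}(Z))_w` is injective on `D`
  obtain ⟨L, hL⟩ : ∃ L : Module.End ℂ (ℂ ⊗[ℚ] V) →ₗ[ℂ] (InfinitePlace E → ℂ),
      ∀ Z w, L Z w = b.repr (Z (b w.embedding)) w.embedding :=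
    ⟨{ toFun := fun Z w => b.repr (Z (b w.embedding)) w.embedding
       map_add' := fun Z Z' => by funext w; simp only [LinearMap.add_apply, map_add, Finsupp.add_apply, Pi.add_apply]
       map_smul' := fun c Z => by
         funext w
         simp only [LinearMap.smul_apply, map_smul, Finsupp.smul_apply, Pi.smul_apply, RingHom.id_apply] },
      fun Z w => rfl⟩
  have hLinj : ∀ Z ∈ D, L Z = 0 → Z = 0 := by
    intro Z hZ hL0
    have hc0 : ∀ w : InfinitePlace E, b.repr (Z (b w.embedding)) w.embedding = 0 := fun w => by
      rw [← hL Z w, hL0, Pi.zero_apply]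
    refine b.ext fun τ => ?_
    rw [LinearMap.zero_apply, hZb Z hZ τ]
    rcases InfinitePlace.embedding_mk_eq τ with h | h
    · rw [← h, hc0, zero_smul]
    · have h2 : b.repr (Z (b τ)) τ = -b.repr (Z (b (ComplexEmbedding.conjugate τ))) (ComplexEmbedding.conjugate τ) := by
        have h3 := hZconj Z hZ (ComplexEmbedding.conjugate τ)
        rw [ComplexEmbedding.involutive_conjugate E τ] at h3
        rw [h3]
      rw [h2, ← h, hc0, neg_zero, zero_smul]
  have hDle : Module.finrank ℂ D ≤ Fintype.card (InfinitePlace E) := by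
    have hinj : Function.Injective (L.domRestrict D) := by
      intro Z Z' h
      apply Subtype.ext
      have h0 : L (Z - Z' : D) = 0 := by
        rw [Submodule.coe_sub, map_sub, sub_eq_zero]; exact h
      exact sub_eq_zero.1 (hLinj _ (Z - Z').2 h0)
    have h := LinearMap.finrank_le_finrank_of_injective hinj
    rwa [Module.finrank_fintype_fun_eq_card] at h
  -- `#(infinite places) ≤ dim_ℚ E⁻ = dim_ℚ 𝔲`: rank–nullity for `x ↦ y₀ (x + x̄)`, `y₀ ∈ E⁻ ∖ 0`
  have hcard : Module.finrank ℚ E = 2 * Fintype.card (InfinitePlace E) := by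
    rw [InfinitePlace.card_eq_nrRealPlaces_add_nrComplexPlaces,
      nrRealPlaces_eq_zero_iff.2 (IsCMField.isTotallyComplex E), zero_add]
    exact IsTotallyComplex.finrank E
  obtain ⟨x₀, hx₀⟩ : ∃ x : E, IsCMField.complexConj E x ≠ x := by
    by_contra! h
    exact IsCMField.complexConj_ne_one E (AlgEquiv.ext h)
  set y₀ : E := x₀ - IsCMField.complexConj E x₀ with hy₀
  have hy₀0 : y₀ ≠ 0 := fun h => hx₀ (sub_eq_zero.1 h).symm
  have hy₀s : IsCMField.complexConj E y₀ = -y₀ := by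
    rw [hy₀, map_sub, IsCMField.complexConj_apply_apply, neg_sub]
  set cE : E →ₗ[ℚ] E := (IsCMField.complexConj E).toRingEquiv.toRingHom.toRatAlgHom.toLinearMap with hcE
  have hcE_apply : ∀ x, cE x = IsCMField.complexConj E x := fun x => rfl
  set m : E →ₗ[ℚ] E := (LinearMap.mulLeft ℚ y₀) ∘ₗ (LinearMap.id + cE) with hm
  have hm_apply : ∀ x, m x = y₀ * (x + IsCMField.complexConj E x) := fun x => rfl
  have hker : LinearMap.ker m = S := by
    ext x
    rw [LinearMap.mem_ker, hm_apply, mul_eq_zero, hS, eq_neg_iff_add_eq_zero, add_comm]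
    exact ⟨fun h => h.resolve_left hy₀0, fun h => Or.inr h⟩
  have hrange : LinearMap.range m ≤ S := by
    rintro _ ⟨x, rfl⟩
    rw [hS, hm_apply, map_mul, hy₀s, map_add, IsCMField.complexConj_apply_apply, add_comm, neg_mul]
  have hSge : Fintype.card (InfinitePlace E) ≤ Module.finrank ℚ S := by
    have h := LinearMap.finrank_range_add_finrank_ker m
    rw [hker, hcard] at h
    have h' := Submodule.finrank_mono hrange
    omega
  haveI : Nontrivial V := by
    obtain ⟨σ⟩ : Nonempty (E →+* ℂ) := inferInstance
    by_contra hV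
    haveI : Subsingleton V := not_nontrivial_iff_subsingleton.1 hV
    haveI : Subsingleton (ℂ ⊗[ℚ] V) := inferInstance
    exact b.ne_zero σ (Subsingleton.elim _ _)
  have h𝔲 : Module.finrank ℚ ↥(S.map A.ι.toLinearMap) = Module.finrank ℚ S :=
    (Submodule.equivMapOfInjective _ (A.ι : E →ₐ[ℚ] Module.End ℚ V).toRingHom.injective S).finrank_eq.symm
  -- `𝔲_ℂ ⊆ D`, `dim D ≤ dim 𝔲_ℂ`, hence `D = 𝔲_ℂ ∋ Y`
  have hle : spanC (S.map A.ι.toLinearMap) ≤ D := by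
    refine Submodule.span_le.2 ?_
    rintro _ ⟨Z, hZ, rfl⟩
    refine (hD _).2 ⟨fun e => ?_, ThetaSubalgebra.formBaseChange_add_eq_zero_of_skew ψ
      (A.form_add_eq_zero_of_mem_map S hS hc hZ)⟩
    rw [← LinearMap.baseChange_mul, A.commute_ι_of_mem_map S hZ e, LinearMap.baseChange_mul]
  have hge : Module.finrank ℂ D ≤ Module.finrank ℂ (spanC (S.map A.ι.toLinearMap)) := by
    rw [finrank_spanC_eq, h𝔲]
    exact hDle.trans hSge
  rw [Submodule.eq_of_le_of_finrank_le hle hge]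
  exact hYD

end EndAction

end HodgeStructure

end Literature.AlgebraicGeometry.Motives

end
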